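import Summits.CriticalPhenomena.PercolationContinuityZ3.Theorems.PercFiniteBoxLRORenormaliseFromLinearLRODefs

/-!
# `stub_coarseDependent` of line `registered` (crux `PercFiniteBoxLRO.RenormaliseFromLinearLRO`,
# stmt-CriticalPhenomena-0857): the coarse law of good blocks is `3`-dependent

Registered stub `stub_coarseDependent` of the lead's skeleton: the law `coarseLaw n p` of the planar
coarse good-edge configuration `coarseCfg n` (blocks `a ∈ ℤ²` ↦ boxes `blockCentre n a + B(n)` of `ℤ³`,
Defs file `PercFiniteBoxLRORenormaliseFromLinearLRODefs.lean`) satisfies the `K`-dependence hypothesis,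
`K = 3`, of the proved dependent-percolation theorem
`Literature.Probability.Percolation.DuminilCopinSidoraviciusTassion2016_dependentPercolation_holds`:
measurable events determined by finite coarse edge sets whose vertices are pairwise at sup-distance `≥ 3`
are independent under `coarseLaw n p` (`1 ≤ n`).

Proof (the `ℤ³`-box analogue of `determinedBy_preimage_coarseConfig` + `disjoint_coarseRegion` of
`SlabCriticalityInputs.lean`, Duminil-Copin–Sidoravicius–Tassion 2016 §2.2; Grimmett 1999 §7.4 p.178):
* `goodBox n` is determined by the pairs inside `B(n)` (`determinedBy_goodBox`, the witness of
  `isLocalEvent_goodBox`), hence `goodBlock n a` by the pairs inside `blockCentre n a + B(n)`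
  (`determinedBy_goodBlock`, pulling back along the shift);
* so the preimage under `coarseCfg n` of an event determined by the coarse edges `F` is determined by the
  pairs inside the blocks of the endpoints of the edges of `F` (`determinedBy_preimage_coarseCfg`);
* blocks of vertices at sup-distance `≥ 3` are disjoint (centres `3n` apart, radius `n`, `n ≥ 1`), so the
  two regions are disjoint (`disjoint_blockRegions`), and events determined by disjoint sets of pairs are
  independent under the product measure `P_p` (`bondPercolation_inter_of_disjoint`, `FiniteEnergy.lean`);
* `coarseLaw n p X = P_p (coarseCfg n ⁻¹' X)` (`Measure.map_apply`).
-/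

noncomputable section

namespace Summit.CriticalPhenomena.PercolationContinuityZ3.Theorems.RenormaliseFromLinearLRO

open Literature.Probability.Percolation Literature.Probability.LatticeModels
open MeasureTheory

/-- `G_n` is determined by the pairs inside `B(n)` (the witness `(box 3 n).sym2` of
`isLocalEvent_goodBox`, re-proved verbatim: configurations agreeing on those pairs induce the same open
graph on the box, and every clause of `G_n` is a reachability statement in that graph). -/
theorem determinedBy_goodBox (n : ℕ) :
    DeterminedBy (goodBox n) (↑((box 3 n).sym2) : Set (Sym2 (Site 3))) := by
  rw [determinedBy_iff]
  intro ω ω' hωω'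
  have hG : (openGraph ω).induce (↑(box 3 n) : Set (Site 3)) =
      (openGraph ω').induce (↑(box 3 n) : Set (Site 3)) := by
    ext a b
    simp only [SimpleGraph.comap_adj, Function.Embedding.coe_subtype, openGraph_adj]
    have he : s((a : Site 3), (b : Site 3)) ∈ (box 3 n).sym2 :=
      Finset.mk_mem_sym2_iff.2 ⟨Finset.mem_coe.1 a.2, Finset.mem_coe.1 b.2⟩
    have hab := Set.ext_iff.1 hωω' s((a : Site 3), (b : Site 3))
    simp only [Set.mem_inter_iff, Finset.mem_coe, he, and_true] at hab
    rw [hab]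
  have hc : ∀ x y : Site 3,
      ω ∈ openConnIn ↑(box 3 n) x y ↔ ω' ∈ openConnIn ↑(box 3 n) x y := by
    intro x y
    simp only [openConnIn, Set.mem_setOf_eq, hG]
  simp only [goodBox, Set.mem_setOf_eq, hc]

/-- Pulling back a determined event along a relabelling of pairs: if `A` is determined by `F` then
`(relabel e)⁻¹ A` is determined by `e⁻¹ F` (cf. `determinedBy_preimage_relabel_bond`). -/
theorem determinedBy_preimage_relabel_pairs {V : Type*} (e : Sym2 V ≃ Sym2 V)
    {A : Set (BondConfig V)} {F : Set (Sym2 V)} (hA : DeterminedBy A F) :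
    DeterminedBy (BondConfig.relabel e ⁻¹' A) (e ⁻¹' F) := by
  rw [determinedBy_iff] at hA ⊢
  intro ω ω' h
  simp only [Set.mem_preimage]
  apply hA
  ext z
  simp only [Set.mem_inter_iff, BondConfig.relabel_apply, Set.mem_image]
  constructor
  · rintro ⟨⟨y, hy, rfl⟩, hz⟩
    have : y ∈ ω' ∩ e ⁻¹' F := by rw [← h]; exact ⟨hy, hz⟩
    exact ⟨⟨y, this.1, rfl⟩, hz⟩
  · rintro ⟨⟨y, hy, rfl⟩, hz⟩
    have : y ∈ ω ∩ e ⁻¹' F := by rw [h]; exact ⟨hy, hz⟩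
    exact ⟨⟨y, this.1, rfl⟩, hz⟩

/-- The good-block event of `a` is determined by the pairs inside the block `blockCentre n a + B(n)`
(the pairs whose shift by `-blockCentre n a` lies in `(box 3 n).sym2`). -/
theorem determinedBy_goodBlock (n : ℕ) (a : Site 2) :
    DeterminedBy (goodBlock n a)
      ((sym2Equiv (Site.shift (-blockCentre n a))) ⁻¹' (↑((box 3 n).sym2) : Set (Sym2 (Site 3)))) :=
  determinedBy_preimage_relabel_pairs _ (determinedBy_goodBox n)

/-- Events of the coarse configuration determined by the coarse edges in `F` pull back to events
determined by the pairs inside the blocks of the endpoints of the edges of `F` ("being good depends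
only on the edges of the block"; DST 2016 §2.2, Grimmett 1999 §7.4 p.178). -/
theorem determinedBy_preimage_coarseCfg (n : ℕ) {A : Set (BondConfig (Site 2))}
    {F : Finset (Sym2 (Site 2))} (hA : DeterminedBy A (↑F : Set (Sym2 (Site 2)))) :
    DeterminedBy (coarseCfg n ⁻¹' A)
      (⋃ e ∈ F, ⋃ a : Site 2, ⋃ (_ : a ∈ e),
        (sym2Equiv (Site.shift (-blockCentre n a))) ⁻¹' (↑((box 3 n).sym2) : Set (Sym2 (Site 3)))) := by
  rw [determinedBy_iff] at hA ⊢
  intro ω ω' h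
  have hloc : ∀ e ∈ F, ∀ a ∈ e, (ω ∈ goodBlock n a ↔ ω' ∈ goodBlock n a) := fun e he a ha =>
    (determinedBy_iff _ _).1 ((determinedBy_goodBlock n a).mono fun d hd =>
      Set.mem_biUnion (Finset.mem_coe.2 he) (Set.mem_iUnion.2 ⟨a, Set.mem_iUnion.2 ⟨ha, hd⟩⟩)) ω ω' h
  have key : ∀ e ∈ F, (e ∈ coarseCfg n ω ↔ e ∈ coarseCfg n ω') := by
    intro e he
    simp only [coarseCfg, Set.mem_setOf_eq]
    refine exists_congr fun x => exists_congr fun i => and_congr_right fun hex => ?_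
    exact and_congr (hloc e he x (hex ▸ Sym2.mem_mk_left _ _))
      (hloc e he _ (hex ▸ Sym2.mem_mk_right _ _))
  simp only [Set.mem_preimage]
  apply hA
  ext e
  simp only [Set.mem_inter_iff, Finset.mem_coe]
  constructor
  · rintro ⟨h1, h2⟩; exact ⟨(key e h2).1 h1, h2⟩
  · rintro ⟨h1, h2⟩; exact ⟨(key e h2).2 h1, h2⟩

/-- **`3`-dependence of the blocks**: the regions of pairs of two families of coarse edges whose
vertices are pairwise at sup-distance `≥ 3` are disjoint (the block centres are `≥ 3n` apart in one
planar coordinate while the blocks have radius `n`, `n ≥ 1`; a common pair would have a vertex in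
both blocks). DST 2016 §2.2 / Grimmett 1999 §7.4 p.178. -/
theorem disjoint_blockRegions {n : ℕ} (hn : 1 ≤ n) {F₁ F₂ : Finset (Sym2 (Site 2))}
    (hfar : ∀ e₁ ∈ F₁, ∀ e₂ ∈ F₂, ∀ a ∈ e₁, ∀ b ∈ e₂, ((3 : ℕ) : ℤ) ≤ max |a 0 - b 0| |a 1 - b 1|) :
    Disjoint
      (⋃ e ∈ F₁, ⋃ a : Site 2, ⋃ (_ : a ∈ e),
        (sym2Equiv (Site.shift (-blockCentre n a))) ⁻¹' (↑((box 3 n).sym2) : Set (Sym2 (Site 3))))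
      (⋃ e ∈ F₂, ⋃ a : Site 2, ⋃ (_ : a ∈ e),
        (sym2Equiv (Site.shift (-blockCentre n a))) ⁻¹' (↑((box 3 n).sym2) : Set (Sym2 (Site 3)))) := by
  rw [Set.disjoint_left]
  intro d hd1 hd2
  simp only [Set.mem_iUnion, Set.mem_preimage, Finset.mem_coe, sym2Equiv_apply, exists_prop] at hd1 hd2
  obtain ⟨e₁, he₁, a, ha, hd₁⟩ := hd1
  obtain ⟨e₂, he₂, b, hb, hd₂⟩ := hd2
  have h3 := hfar e₁ he₁ e₂ he₂ a ha b hb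
  push_cast at h3
  obtain ⟨v, hv⟩ : ∃ v, v ∈ d := ⟨d.out.1, Sym2.out_fst_mem d⟩
  have hv₁ : v + -blockCentre n a ∈ box 3 n :=
    Finset.mem_sym2_iff.1 hd₁ _ (Sym2.mem_map.2 ⟨v, hv, rfl⟩)
  have hv₂ : v + -blockCentre n b ∈ box 3 n :=
    Finset.mem_sym2_iff.1 hd₂ _ (Sym2.mem_map.2 ⟨v, hv, rfl⟩)
  rw [mem_box] at hv₁ hv₂
  have h0 := hv₁ 0
  have h1 := hv₁ 1
  have h0' := hv₂ 0
  have h1' := hv₂ 1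
  simp only [blockCentre, Pi.add_apply, Pi.neg_apply, Matrix.cons_val_zero,
    Matrix.cons_val_one] at h0 h1 h0' h1'
  have hn0 : (0 : ℤ) ≤ n := by positivity
  have hcp : 3 * (n : ℤ) ≤ |(n : ℤ) * a 0 - n * b 0| ∨ 3 * (n : ℤ) ≤ |(n : ℤ) * a 1 - n * b 1| := by
    rcases le_max_iff.1 h3 with h | h
    · left
      rw [← mul_sub, abs_mul, abs_of_nonneg hn0]
      have := mul_le_mul_of_nonneg_left h hn0
      linarith
    · right
      rw [← mul_sub, abs_mul, abs_of_nonneg hn0]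
      have := mul_le_mul_of_nonneg_left h hn0
      linarith
  rw [le_abs, le_abs] at hcp
  omega

/-- **Registered stub `stub_coarseDependent` of crux stmt-CriticalPhenomena-0857 (line `registered`)**:
the coarse law `coarseLaw n p` of the good-block configuration is `3`-dependent in exactly the
hypothesis form of `DuminilCopinSidoraviciusTassion2016_dependentPercolation` (`K = 3`): measurable
events `A`, `B` determined by finite coarse edge sets `F₁`, `F₂` whose vertices are pairwise at
sup-distance `≥ 3` satisfy `coarseLaw n p (A ∩ B) = coarseLaw n p A * coarseLaw n p B` (`1 ≤ n`).
Duminil-Copin–Sidoravicius–Tassion 2016 §2.2; Grimmett 1999 §7.4 (7.57)–(7.58). -/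
theorem stub_coarseDependent :
    ∀ (p : unitInterval) (n : ℕ), 1 ≤ n →
      ∀ (F₁ F₂ : Finset (Sym2 (Site 2))),
        (∀ e₁ ∈ F₁, ∀ e₂ ∈ F₂, ∀ a ∈ e₁, ∀ b ∈ e₂, ((3 : ℕ) : ℤ) ≤ max |a 0 - b 0| |a 1 - b 1|) →
        ∀ (A B : Set (BondConfig (Site 2))), DeterminedBy A (↑F₁ : Set (Sym2 (Site 2))) →
          DeterminedBy B (↑F₂ : Set (Sym2 (Site 2))) → MeasurableSet A → MeasurableSet B →
          coarseLaw n p (A ∩ B) = coarseLaw n p A * coarseLaw n p B := by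
  intro p n hn F₁ F₂ hfar A B hA hB hAm hBm
  simp only [coarseLaw, Measure.map_apply (measurable_coarseCfg n) (hAm.inter hBm),
    Measure.map_apply (measurable_coarseCfg n) hAm, Measure.map_apply (measurable_coarseCfg n) hBm,
    Set.preimage_inter]
  exact bondPercolation_inter_of_disjoint (zdGraph 3) p (disjoint_blockRegions hn hfar)
    (determinedBy_preimage_coarseCfg n hA) (determinedBy_preimage_coarseCfg n hB)
    (hAm.preimage (measurable_coarseCfg n)) (hBm.preimage (measurable_coarseCfg n))

end Summit.CriticalPhenomena.PercolationContinuityZ3.Theorems.RenormaliseFromLinearLRO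

end
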